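import Literature.Topology.FourManifolds.LickorishWallace
import Literature.Topology.FourManifolds.LickorishTwistSurgery
import Literature.Topology.FourManifolds.Handles
import Literature.Topology.FourManifolds.GluingPieces
import Literature.Geometry.Manifold.EmbeddingRangeDiffeomorph
import HarnessLib

/-!
# Waldhausen's theorem: Heegaard splittings of `#ᵏ(S¹ × S²)` are unique (Waldhausen 1968)

Topic `Literature/Topology/FourManifolds` (cite/fact item `wi-25606`, wanted by route
`SmoothPoincare4/CongruenceShadows`, item `WaldhausenPairs`).  One NAMED FACT (D-0014), no
definition, nothing proved:

* `Literature.Topology.FourManifolds.waldhausen_heegaardSplitting_sumS1S2_unique` — **Waldhausen's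
  theorem.**  Meier–Schirmer–Zupan (2016), Thm. 2.7, verbatim: "Theorem 2.7 [Waldhausen 1968].
  Suppose `Y ≅ #ᵏ(S¹ × S²)`.  Then for all `g ≥ k ≥ 0`, there is a unique genus `g` Heegaard
  splitting of `Y` up to isotopy."  (Loc. cit., p. 4: "throughout, we define `#⁰(S¹ × S²) = S³`";
  the case `k = 0` is Waldhausen's theorem on the `3`-sphere, Schultens (2014), Thm. 6.4.6: "The
  3-sphere has a unique Heegaard splitting of any given genus.")  Vendored in the weaker
  *diffeomorphism* form that the route consumes ("unique up to diffeomorphism of triples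
  `(Y; H₁, H₂)`", implied by uniqueness up to isotopy): any two genus-`g` Heegaard splittings
  `Y = H₁ ∪_f H₂ = H₁' ∪_{f'} H₂'` of such a `Y` are related by a self-diffeomorphism `Φ` of `Y`
  carrying `H₁` onto `H₁'` and `H₂` onto `H₂'`.

## Vocabulary (all existing; nothing is re-declared)

* Heegaard splittings are the tree's relational ones (`LickorishWallace.lean`): genus-`g`
  handlebodies `Literature.Topology.FourManifolds.IsHandlebody g H` (compact connected orientable smooth `3`-manifold with
  boundary with one `0`-handle and `g` `1`-handles) glued along a diffeomorphism `f : ∂H₁ ≅ ∂H₂` of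
  their boundary data; here with the two embeddings `j₁ : H₁ ↪ Y`, `j₂ : H₂ ↪ Y` *exposed*
  (`Literature.Topology.FourManifolds.IsBoundaryGluingWith`, `LickorishTwistSurgery.lean`; `IsHeegaardSplitting g b₁ b₂ f Y` is
  `IsHandlebody g H₁ ∧ IsHandlebody g H₂ ∧ ∃ j₁ j₂, IsBoundaryGluingWith b₁ b₂ f (𝓡 3) j₁ j₂`), so
  that "`Φ` carries `Hᵢ` onto `Hᵢ'`" can be said: `Φ ∘ jᵢ = jᵢ' ∘ ψᵢ` for diffeomorphisms
  `ψᵢ : Hᵢ ≅ Hᵢ'` — a diffeomorphism of triples `(Y; H₁, H₂) → (Y; H₁', H₂')`.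
* "`Y ≅ #ᵏ(S¹ × S²)` for some `k ≥ 0`" is said as everywhere in this topic (the Laudenbach–Poénaru
  facts of `SPC4HandlesProofs.lean`, the trisection sectors of `Trisections.lean`): `Y` is
  diffeomorphic to the boundary `bV.carrier` of a compact connected orientable smooth
  `4`-dimensional `1`-handlebody `V` (`Literature.Topology.FourManifolds.IsHandlebodyOfIndexLE 3 1 V`: handles of index `≤ 1`
  only), i.e. `V ≅ ♮ᵏ(S¹ × B³)` and `∂V ≅ #ᵏ(S¹ × S²)` (Kirby (1989), Ch. I §2, p. 8), `k` the
  number of `1`-handles after cancelling the surplus `0`-handles; `k = 0` gives `V = B⁴`,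
  `∂V = S³`.  The genus bound `g ≥ k` of the printed statement is automatic for a genus-`g`
  splitting of `#ᵏ(S¹ × S²)` (rank of `H₁`) and is not a hypothesis.

## Why only the diffeomorphism form

The printed "unique up to isotopy" (an ambient isotopy of `Y` from the identity to `Φ`) implies
the vendored statement and is all that the consumer needs: on fundamental groups a
diffeomorphism of triples induces an automorphism of `π₁` of the Heegaard surface carrying the
kernel pair `(ker π₁Σ → π₁H₁, ker π₁Σ → π₁H₂)` of one splitting to that of the other (route
`CongruenceShadows`, item `WaldhausenPairs`, which combines this fact with handlebody realisation
of epimorphisms `S_g ↠ F_g`, Kneser–Stallings–Perelman and Dehn–Nielsen–Baer — none of which is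
asserted here).  Nothing is claimed about isotopy, orientations, or the standard `(g,k)`-diagram.

## References

* F. Waldhausen, *Heegaard-Zerlegungen der 3-Sphäre*, Topology 7 (1968), 195–203 (the original;
  paywalled, acquisition request `acq-02845`; cited through the modern statements below).
* J. Meier, T. Schirmer, A. Zupan, *Classification of trisections and the generalized property R
  conjecture*, Proc. AMS 144 (2016), 4983–4997 = arXiv:1507.06561, §2, Thm. 2.7 (read: held copy
  `paper:arxiv-1507.06561`, p. 4).
* J. Schultens, *Introduction to 3-Manifolds*, GSM 151 (2014), Thm. 6.4.6 (the case `S³`; held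
  copy, PDF p. 127) and §6.3 (stabilisation).
* M. Scharlemann, *Heegaard splittings of compact 3-manifolds*, Handbook of Geometric Topology
  (2002) = arXiv:math/0007144, Thm. 3.7 (the case `S³`).
* R. Kirby, *The Topology of 4-Manifolds*, LNM 1374 (1989), Ch. I §2, p. 8 (`♮ᵏ S¹ × B³` and its
  boundary `#ᵏ S¹ × S²`).
-/

open scoped Manifold ContDiff Topology
open Function Set

noncomputable section

namespace Literature.Topology.FourManifolds

universe u

/-- **Waldhausen's theorem (Heegaard splittings of `#ᵏ(S¹ × S²)`, in particular of `S³`, are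
unique).**  Meier–Schirmer–Zupan (2016), Thm. 2.7 [Waldhausen 1968]: "Suppose
`Y ≅ #ᵏ(S¹ × S²)`.  Then for all `g ≥ k ≥ 0`, there is a unique genus `g` Heegaard splitting of
`Y` up to isotopy" (with `#⁰(S¹ × S²) = S³`: Schultens (2014), Thm. 6.4.6, "The 3-sphere has a
unique Heegaard splitting of any given genus").  Vendored in the (weaker) diffeomorphism-of-triples
form: let `V` be a compact connected orientable smooth `4`-dimensional `1`-handlebody
(`V ≅ ♮ᵏ S¹ × B³`, so `∂V ≅ #ᵏ S¹ × S²`, Kirby (1989), Ch. I §2, p. 8) with boundary datum `bV`, and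
let `Y` be a smooth `3`-manifold diffeomorphic to `bV.carrier`.  If `Y = H₁ ∪_f H₂` (pieces embedded
by `j₁`, `j₂`) and `Y = H₁' ∪_{f'} H₂'` (pieces embedded by `j₁'`, `j₂'`) are two genus-`g` Heegaard
splittings of `Y` (`IsHandlebody`, `IsBoundaryGluingWith`), then there are a diffeomorphism
`Φ : Y ≅ Y` and diffeomorphisms `ψ₁ : H₁ ≅ H₁'`, `ψ₂ : H₂ ≅ H₂'` with `Φ ∘ j₁ = j₁' ∘ ψ₁` and
`Φ ∘ j₂ = j₂' ∘ ψ₂` (`Φ` carries `H₁` onto `H₁'` and `H₂` onto `H₂'`).  Named fact (D-0014); users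
take `(h : waldhausen_heegaardSplitting_sumS1S2_unique)`.
[cite: MeierSchirmerZupan2016, Thm. 2.7] [cite: Waldhausen1968, pp. 195–203 (the original)]
[cite: Schultens2014, Thm. 6.4.6 (the case S³)] -/
def waldhausen_heegaardSplitting_sumS1S2_unique : Prop :=
  ∀ (V : Type u) [TopologicalSpace V] [T2Space V] [SecondCountableTopology V] [CompactSpace V]
    [ConnectedSpace V] [ChartedSpace (EuclideanHalfSpace 4) V] [IsManifold (𝓡∂ 4) ∞ V]
    (_ : IsHandlebodyOfIndexLE 3 1 V) (_ : IsOrientable (𝓡∂ 4) V)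
    (bV : BoundaryData (𝓡∂ 4) V (𝓡 3))
    (Y : Type u) [TopologicalSpace Y] [T2Space Y] [SecondCountableTopology Y]
    [ChartedSpace (EuclideanSpace ℝ (Fin 3)) Y] [IsManifold (𝓡 3) ∞ Y]
    (_ : Nonempty (Y ≃ₘ⟮𝓡 3, 𝓡 3⟯ bV.carrier)) (g : ℕ)
    -- the first genus-`g` Heegaard splitting `Y = H₁ ∪_f H₂`, pieces embedded by `j₁`, `j₂`
    (H₁ : Type u) [TopologicalSpace H₁] [ChartedSpace (EuclideanHalfSpace 3) H₁]
    [IsManifold (𝓡∂ 3) ∞ H₁]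
    (H₂ : Type u) [TopologicalSpace H₂] [ChartedSpace (EuclideanHalfSpace 3) H₂]
    [IsManifold (𝓡∂ 3) ∞ H₂]
    (b₁ : BoundaryData (𝓡∂ 3) H₁ (𝓡 2)) (b₂ : BoundaryData (𝓡∂ 3) H₂ (𝓡 2))
    (f : b₁.carrier ≃ₘ⟮𝓡 2, 𝓡 2⟯ b₂.carrier) (j₁ : H₁ → Y) (j₂ : H₂ → Y)
    (_ : IsHandlebody g H₁) (_ : IsHandlebody g H₂) (_ : IsBoundaryGluingWith b₁ b₂ f (𝓡 3) j₁ j₂)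
    -- the second genus-`g` Heegaard splitting `Y = H₁' ∪_{f'} H₂'`, pieces embedded by `j₁'`, `j₂'`
    (H₁' : Type u) [TopologicalSpace H₁'] [ChartedSpace (EuclideanHalfSpace 3) H₁']
    [IsManifold (𝓡∂ 3) ∞ H₁']
    (H₂' : Type u) [TopologicalSpace H₂'] [ChartedSpace (EuclideanHalfSpace 3) H₂']
    [IsManifold (𝓡∂ 3) ∞ H₂']
    (b₁' : BoundaryData (𝓡∂ 3) H₁' (𝓡 2)) (b₂' : BoundaryData (𝓡∂ 3) H₂' (𝓡 2))
    (f' : b₁'.carrier ≃ₘ⟮𝓡 2, 𝓡 2⟯ b₂'.carrier) (j₁' : H₁' → Y) (j₂' : H₂' → Y)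
    (_ : IsHandlebody g H₁') (_ : IsHandlebody g H₂')
    (_ : IsBoundaryGluingWith b₁' b₂' f' (𝓡 3) j₁' j₂'),
    ∃ (Φ : Y ≃ₘ⟮𝓡 3, 𝓡 3⟯ Y) (ψ₁ : H₁ ≃ₘ⟮𝓡∂ 3, 𝓡∂ 3⟯ H₁') (ψ₂ : H₂ ≃ₘ⟮𝓡∂ 3, 𝓡∂ 3⟯ H₂'),
      Φ ∘ j₁ = j₁' ∘ ψ₁ ∧ Φ ∘ j₂ = j₂' ∘ ψ₂

/-! ### API: transporting a splitting along a diffeomorphism; the two-manifold form -/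

section Transport

variable {EM HM EN HN E₀ H₀ E₀' H₀' EP HP : Type*}
  [NormedAddCommGroup EM] [NormedSpace ℝ EM] [TopologicalSpace HM] {IM : ModelWithCorners ℝ EM HM}
  [NormedAddCommGroup EN] [NormedSpace ℝ EN] [TopologicalSpace HN] {IN : ModelWithCorners ℝ EN HN}
  [NormedAddCommGroup E₀] [NormedSpace ℝ E₀] [TopologicalSpace H₀] {I₀ : ModelWithCorners ℝ E₀ H₀}
  [NormedAddCommGroup E₀'] [NormedSpace ℝ E₀'] [TopologicalSpace H₀']
  {I₀' : ModelWithCorners ℝ E₀' H₀'}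
  [NormedAddCommGroup EP] [NormedSpace ℝ EP] [TopologicalSpace HP] {IP : ModelWithCorners ℝ EP HP}
  {M : Type u} [TopologicalSpace M] [ChartedSpace HM M]
  {N : Type u} [TopologicalSpace N] [ChartedSpace HN N]
  {bM : BoundaryData IM M I₀} {bN : BoundaryData IN N I₀'} {φ : bM.carrier → bN.carrier}
  {P : Type*} [TopologicalSpace P] [ChartedSpace HP P]
  {P' : Type*} [TopologicalSpace P'] [ChartedSpace HP P']

/-- **Transport of a gluing along a diffeomorphism.**  If `P = M ∪_φ N` with pieces embedded by
`jM`, `jN` and `e : P ≅ P'` is a diffeomorphism, then `P' = M ∪_φ N` with pieces embedded by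
`e ∘ jM`, `e ∘ jN` (smooth embeddings compose with diffeomorphisms,
`Manifold.IsSmoothEmbedding.diffeomorph_comp`; the pieces still cover and meet along the same
seam because `e` is bijective).  Hirsch, *Differential Topology* (1976), §8.2. [folklore] -/
theorem IsBoundaryGluingWith.diffeomorph_comp [IsManifold IP ∞ P] [IsManifold IP ∞ P']
    {jM : M → P} {jN : N → P} (h : IsBoundaryGluingWith bM bN φ IP jM jN)
    (e : P ≃ₘ⟮IP, IP⟯ P') : IsBoundaryGluingWith bM bN φ IP (e ∘ jM) (e ∘ jN) := by
  refine ⟨h.1.diffeomorph_comp e, h.2.1.diffeomorph_comp e, ?_, fun x y => ?_⟩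
  · rw [Set.range_comp, Set.range_comp, ← Set.image_union, h.2.2.1, Set.image_univ]
    exact Set.range_eq_univ.mpr e.surjective
  · rw [Function.comp_apply, Function.comp_apply, ← h.2.2.2 x y]
    exact e.injective.eq_iff

end Transport

/-- **Waldhausen's theorem, two-manifold form** (proved from the named fact): two genus-`g`
Heegaard splittings `Y = H₁ ∪_f H₂`, `Y' = H₁' ∪_{f'} H₂'` of smooth `3`-manifolds `Y`, `Y'` *both*
diffeomorphic to the boundary of the same compact connected orientable `4`-dimensional
`1`-handlebody `V` (`≅ #ᵏ S¹ × S²`) are diffeomorphic as triples: there are diffeomorphisms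
`Φ : Y ≅ Y'`, `ψ₁ : H₁ ≅ H₁'`, `ψ₂ : H₂ ≅ H₂'` with `Φ ∘ j₁ = j₁' ∘ ψ₁`, `Φ ∘ j₂ = j₂' ∘ ψ₂`.
(Transport the second splitting to `Y` along `Y' ≅ ∂V ≅ Y`, `IsBoundaryGluingWith.diffeomorph_comp`,
apply the fact in `Y`, and compose back.)  Meier–Schirmer–Zupan (2016), Thm. 2.7.
[cite: MeierSchirmerZupan2016, Thm. 2.7] -/
theorem waldhausen_heegaardSplitting_sumS1S2_unique.two_manifolds
    (h : waldhausen_heegaardSplitting_sumS1S2_unique.{u}) :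
    ∀ (V : Type u) [TopologicalSpace V] [T2Space V] [SecondCountableTopology V] [CompactSpace V]
    [ConnectedSpace V] [ChartedSpace (EuclideanHalfSpace 4) V] [IsManifold (𝓡∂ 4) ∞ V]
    (_ : IsHandlebodyOfIndexLE 3 1 V) (_ : IsOrientable (𝓡∂ 4) V)
    (bV : BoundaryData (𝓡∂ 4) V (𝓡 3))
    (Y : Type u) [TopologicalSpace Y] [T2Space Y] [SecondCountableTopology Y]
    [ChartedSpace (EuclideanSpace ℝ (Fin 3)) Y] [IsManifold (𝓡 3) ∞ Y]
    (_ : Nonempty (Y ≃ₘ⟮𝓡 3, 𝓡 3⟯ bV.carrier))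
    (Y' : Type u) [TopologicalSpace Y'] [T2Space Y'] [SecondCountableTopology Y']
    [ChartedSpace (EuclideanSpace ℝ (Fin 3)) Y'] [IsManifold (𝓡 3) ∞ Y']
    (_ : Nonempty (Y' ≃ₘ⟮𝓡 3, 𝓡 3⟯ bV.carrier)) (g : ℕ)
    (H₁ : Type u) [TopologicalSpace H₁] [ChartedSpace (EuclideanHalfSpace 3) H₁]
    [IsManifold (𝓡∂ 3) ∞ H₁]
    (H₂ : Type u) [TopologicalSpace H₂] [ChartedSpace (EuclideanHalfSpace 3) H₂]
    [IsManifold (𝓡∂ 3) ∞ H₂]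
    (b₁ : BoundaryData (𝓡∂ 3) H₁ (𝓡 2)) (b₂ : BoundaryData (𝓡∂ 3) H₂ (𝓡 2))
    (f : b₁.carrier ≃ₘ⟮𝓡 2, 𝓡 2⟯ b₂.carrier) (j₁ : H₁ → Y) (j₂ : H₂ → Y)
    (_ : IsHandlebody g H₁) (_ : IsHandlebody g H₂) (_ : IsBoundaryGluingWith b₁ b₂ f (𝓡 3) j₁ j₂)
    (H₁' : Type u) [TopologicalSpace H₁'] [ChartedSpace (EuclideanHalfSpace 3) H₁']
    [IsManifold (𝓡∂ 3) ∞ H₁']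
    (H₂' : Type u) [TopologicalSpace H₂'] [ChartedSpace (EuclideanHalfSpace 3) H₂']
    [IsManifold (𝓡∂ 3) ∞ H₂']
    (b₁' : BoundaryData (𝓡∂ 3) H₁' (𝓡 2)) (b₂' : BoundaryData (𝓡∂ 3) H₂' (𝓡 2))
    (f' : b₁'.carrier ≃ₘ⟮𝓡 2, 𝓡 2⟯ b₂'.carrier) (j₁' : H₁' → Y') (j₂' : H₂' → Y')
    (_ : IsHandlebody g H₁') (_ : IsHandlebody g H₂')
    (_ : IsBoundaryGluingWith b₁' b₂' f' (𝓡 3) j₁' j₂'),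
    ∃ (Φ : Y ≃ₘ⟮𝓡 3, 𝓡 3⟯ Y') (ψ₁ : H₁ ≃ₘ⟮𝓡∂ 3, 𝓡∂ 3⟯ H₁') (ψ₂ : H₂ ≃ₘ⟮𝓡∂ 3, 𝓡∂ 3⟯ H₂'),
      Φ ∘ j₁ = j₁' ∘ ψ₁ ∧ Φ ∘ j₂ = j₂' ∘ ψ₂ := by
  intro V _ _ _ _ _ _ _ hV hVo bV Y _ _ _ _ _ hY Y' _ _ _ _ _ hY' g H₁ _ _ _ H₂ _ _ _ b₁ b₂ f j₁ j₂
    hH₁ hH₂ hj H₁' _ _ _ H₂' _ _ _ b₁' b₂' f' j₁' j₂' hH₁' hH₂' hj'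
  obtain ⟨eY⟩ := hY
  obtain ⟨eY'⟩ := hY'
  -- `e : Y' ≅ Y` through the common model `∂V`
  set e : Y' ≃ₘ⟮𝓡 3, 𝓡 3⟯ Y := eY'.trans eY.symm with he
  obtain ⟨Φ₀, ψ₁, ψ₂, hΦ₁, hΦ₂⟩ := h V hV hVo bV Y ⟨eY⟩ g H₁ H₂ b₁ b₂ f j₁ j₂ hH₁ hH₂ hj
    H₁' H₂' b₁' b₂' f' (e ∘ j₁') (e ∘ j₂') hH₁' hH₂' (hj'.diffeomorph_comp e)
  refine ⟨Φ₀.trans e.symm, ψ₁, ψ₂, ?_, ?_⟩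
  · funext x
    have hx := congrFun hΦ₁ x
    simp only [Function.comp_apply] at hx
    simp only [Function.comp_apply, Diffeomorph.coe_trans, hx, Diffeomorph.symm_apply_apply]
  · funext x
    have hx := congrFun hΦ₂ x
    simp only [Function.comp_apply] at hx
    simp only [Function.comp_apply, Diffeomorph.coe_trans, hx, Diffeomorph.symm_apply_apply]

/-! ### API: from a diffeomorphism of pairs to a diffeomorphism of triples (appended)

Uniqueness theorems for Heegaard splittings — Waldhausen's theorem in particular — are proved on
the level of SUBSETS of `Y`: one produces a diffeomorphism (indeed an isotopy) `Φ` of `Y` carrying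
the first handlebody `j₁(H₁) ⊆ Y` of one splitting onto the first handlebody `j₁'(H₁') ⊆ Y` of the
other (Meier–Schirmer–Zupan (2016), §2, p. 4: "an isotopy of `Y` taking `Σ'` to `Σ''` and `H_α'`
to `H_α''`").  The named fact above is phrased on the level of the PIECES (`Φ ∘ j₁ = j₁' ∘ ψ₁`,
`Φ ∘ j₂ = j₂' ∘ ψ₂`).  The lemmas of this section close that gap once and for all, for arbitrary
gluings along the boundary (`IsBoundaryGluingWith`, any models): the diffeomorphisms of the pieces
`ψM`, `ψN` exist as soon as `Φ` carries `range jM` onto `range jM'`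
(`IsBoundaryGluingWith.exists_diffeomorph_pieces`).  Ingredients: two smooth embeddings with the
same image have diffeomorphic sources, compatibly (Lee, *Introduction to Smooth Manifolds* (2013),
Thm. 5.31; the tree's `Literature.Geometry.Manifold.exists_diffeomorph_comp_eq_of_range_eq`); the
second piece of a gluing is the complement of the first together with the seam `jM(∂M)`
(`IsBoundaryGluingWith.range_right_eq`, from `range_inter_range_eq` of `GluingPieces.lean`); and
diffeomorphisms preserve boundaries (Mathlib `Diffeomorph.image_boundary`), so the condition on the
second piece is automatic.  Everything here is proved; no definition, no named fact.
-/

section Pieces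

universe v

variable {EM HM EN HN E₀ H₀ E₀' H₀' FM GM FN GN F₀ G₀ F₀' G₀' EP HP : Type*}
  [NormedAddCommGroup EM] [NormedSpace ℝ EM] [TopologicalSpace HM] {IM : ModelWithCorners ℝ EM HM}
  [NormedAddCommGroup EN] [NormedSpace ℝ EN] [TopologicalSpace HN] {IN : ModelWithCorners ℝ EN HN}
  [NormedAddCommGroup E₀] [NormedSpace ℝ E₀] [TopologicalSpace H₀] {I₀ : ModelWithCorners ℝ E₀ H₀}
  [NormedAddCommGroup E₀'] [NormedSpace ℝ E₀'] [TopologicalSpace H₀']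
  {I₀' : ModelWithCorners ℝ E₀' H₀'}
  [NormedAddCommGroup FM] [NormedSpace ℝ FM] [TopologicalSpace GM] {JM : ModelWithCorners ℝ FM GM}
  [NormedAddCommGroup FN] [NormedSpace ℝ FN] [TopologicalSpace GN] {JN : ModelWithCorners ℝ FN GN}
  [NormedAddCommGroup F₀] [NormedSpace ℝ F₀] [TopologicalSpace G₀] {J₀ : ModelWithCorners ℝ F₀ G₀}
  [NormedAddCommGroup F₀'] [NormedSpace ℝ F₀'] [TopologicalSpace G₀']
  {J₀' : ModelWithCorners ℝ F₀' G₀'}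
  [NormedAddCommGroup EP] [NormedSpace ℝ EP] [TopologicalSpace HP] {IP : ModelWithCorners ℝ EP HP}
  {M : Type u} [TopologicalSpace M] [ChartedSpace HM M]
  {N : Type u} [TopologicalSpace N] [ChartedSpace HN N]
  {M' : Type v} [TopologicalSpace M'] [ChartedSpace GM M']
  {N' : Type v} [TopologicalSpace N'] [ChartedSpace GN N']
  {bM : BoundaryData IM M I₀} {bN : BoundaryData IN N I₀'} {φ : bM.carrier → bN.carrier}
  {bM' : BoundaryData JM M' J₀} {bN' : BoundaryData JN N' J₀'} {φ' : bM'.carrier → bN'.carrier}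
  {P : Type*} [TopologicalSpace P] [ChartedSpace HP P]
  {P' : Type*} [TopologicalSpace P'] [ChartedSpace HP P']
  {jM : M → P} {jN : N → P} {jM' : M' → P'} {jN' : N' → P'}

/-- **The pieces of a gluing meet exactly along the image of the boundary of the first piece**:
`range jM ∩ range jN = jM(∂M)` (`range_inter_range_eq` of `GluingPieces.lean` together with
`range incl = ∂M`).  Hirsch, *Differential Topology* (1976), §8.2 ("`M` and `N` meet along
`∂M ≡ ∂N`"). [folklore] -/
theorem IsBoundaryGluingWith.range_inter_range (h : IsBoundaryGluingWith bM bN φ IP jM jN) :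
    range jM ∩ range jN = jM '' IM.boundary M := by
  rw [range_inter_range_eq h.2.2.2, Set.range_comp, bM.range_incl, Set.image_eq_range]

/-- **The second piece of a gluing is the complement of the first together with the seam**:
`range jN = (range jM)ᶜ ∪ jM(∂M)` (the pieces cover `P` and meet exactly along `jM(∂M)`).
Hirsch, *Differential Topology* (1976), §8.2. [folklore] -/
theorem IsBoundaryGluingWith.range_right_eq (h : IsBoundaryGluingWith bM bN φ IP jM jN) :
    range jN = (range jM)ᶜ ∪ jM '' IM.boundary M := by
  rw [← h.range_inter_range]
  ext p
  constructor
  · intro hp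
    by_cases hpM : p ∈ range jM
    · exact Or.inr ⟨hpM, hp⟩
    · exact Or.inl hpM
  · rintro (hp | hp)
    · exact h.mem_range_right_of_not_mem hp
    · exact hp.2

/-- **From a diffeomorphism of pairs to a diffeomorphism of triples.**  Let `P = M ∪_φ N` (pieces
embedded by `jM`, `jN`) and `P' = M' ∪_{φ'} N'` (pieces embedded by `jM'`, `jN'`) be gluings along
the boundary, and let `Φ : P ≅ P'` be a diffeomorphism carrying the first piece onto the first
piece, `Φ(jM(M)) = jM'(M')`.  Then `Φ` is a diffeomorphism of triples: there are diffeomorphisms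
`ψM : M ≅ M'`, `ψN : N ≅ N'` with `Φ ∘ jM = jM' ∘ ψM` and `Φ ∘ jN = jN' ∘ ψN`.  Proof: `Φ ∘ jM` and
`jM'` are smooth embeddings with the same image, hence differ by a diffeomorphism of their sources
(Lee (2013), Thm. 5.31, `Literature.Geometry.Manifold.exists_diffeomorph_comp_eq_of_range_eq`);
`Φ` then also carries `jN(N) = (jM(M))ᶜ ∪ jM(∂M)` onto `jN'(N')` because `Φ` is bijective and
`ψM(∂M) = ∂M'` (Mathlib `Diffeomorph.image_boundary`), and the same argument gives `ψN`.  This is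
the form in which uniqueness statements for Heegaard splittings proved "on subsets" (an isotopy
of `Y` taking `H_α` to `H_α'`, Meier–Schirmer–Zupan (2016), §2) feed the piece-wise phrasing of
`waldhausen_heegaardSplitting_sumS1S2_unique`. [cite: LeeSmoothManifolds2013, Thm. 5.31] -/
theorem IsBoundaryGluingWith.exists_diffeomorph_pieces [IsManifold IP ∞ P] [IsManifold IP ∞ P']
    (h : IsBoundaryGluingWith bM bN φ IP jM jN) (h' : IsBoundaryGluingWith bM' bN' φ' IP jM' jN')
    (Φ : P ≃ₘ⟮IP, IP⟯ P') (hΦ : Φ '' range jM = range jM') :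
    ∃ (ψM : M ≃ₘ⟮IM, JM⟯ M') (ψN : N ≃ₘ⟮IN, JN⟯ N'),
      Φ ∘ jM = jM' ∘ ψM ∧ Φ ∘ jN = jN' ∘ ψN := by
  -- the first pieces: `Φ ∘ jM` and `jM'` are smooth embeddings with the same image
  obtain ⟨ψM, hψM⟩ := Literature.Geometry.Manifold.exists_diffeomorph_comp_eq_of_range_eq
    (h.1.diffeomorph_comp Φ) h'.1 (by rw [Set.range_comp, hΦ])
  have hM : (Φ : P → P') ∘ jM = jM' ∘ (ψM : M → M') := funext fun x => (hψM x).symm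
  -- the second piece is the complement of the first together with the seam, which `Φ` respects
  have hbij : Function.Bijective (Φ : P → P') := ⟨Φ.injective, Φ.surjective⟩
  have hΦN : Φ '' range jN = range jN' := by
    rw [h.range_right_eq, h'.range_right_eq, Set.image_union, Set.image_compl_eq hbij, hΦ,
      ← Set.image_comp, hM, Set.image_comp, ψM.image_boundary (by simp)]
  obtain ⟨ψN, hψN⟩ := Literature.Geometry.Manifold.exists_diffeomorph_comp_eq_of_range_eq
    (h.2.1.diffeomorph_comp Φ) h'.2.1 (by rw [Set.range_comp, hΦN])
  exact ⟨ψM, ψN, hM, funext fun y => (hψN y).symm⟩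

/-- **`M ∪_φ N` is `N ∪_{φ⁻¹} M`, with the same pieces**: for a gluing BIJECTION `φ` the
explicit-witness gluing predicate is symmetric (the `IsBoundaryGluingWith` form of
`IsBoundaryGluing.symm`, `Gluing.lean`).  Hirsch, *Differential Topology* (1976), §8.2.
[folklore] -/
theorem IsBoundaryGluingWith.symm_equiv {φ : bM.carrier ≃ bN.carrier}
    (h : IsBoundaryGluingWith bM bN φ IP jM jN) : IsBoundaryGluingWith bN bM φ.symm IP jN jM := by
  refine ⟨h.2.1, h.1, by rw [Set.union_comm]; exact h.2.2.1, fun y x => ?_⟩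
  rw [eq_comm, h.2.2.2 x y]
  constructor
  · rintro ⟨z, hx, hy⟩
    exact ⟨φ z, hy, by simpa using hx⟩
  · rintro ⟨w, hy, hx⟩
    exact ⟨φ.symm w, hx, by simpa using hy⟩

/-- `M ∪_φ N` is `N ∪_{φ⁻¹} M` with the same pieces, for a gluing DIFFEOMORPHISM `φ` (the form in
which Heegaard splittings are glued). Hirsch (1976), §8.2. [folklore] -/
theorem IsBoundaryGluingWith.symm_diffeomorph {φ : bM.carrier ≃ₘ⟮I₀, I₀'⟯ bN.carrier}
    (h : IsBoundaryGluingWith bM bN φ IP jM jN) : IsBoundaryGluingWith bN bM φ.symm IP jN jM :=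
  IsBoundaryGluingWith.symm_equiv (φ := φ.toEquiv) h

/-- The same with the roles of the pieces exchanged, for gluing bijections `φ`, `φ'`: a
diffeomorphism `Φ : P ≅ P'` carrying the SECOND piece onto the second piece,
`Φ(jN(N)) = jN'(N')`, is a diffeomorphism of triples (apply
`IsBoundaryGluingWith.exists_diffeomorph_pieces` to the symmetric gluings `N ∪_{φ⁻¹} M`,
`N' ∪_{φ'⁻¹} M'`). [cite: LeeSmoothManifolds2013, Thm. 5.31] -/
theorem IsBoundaryGluingWith.exists_diffeomorph_pieces' [IsManifold IP ∞ P] [IsManifold IP ∞ P']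
    {φ : bM.carrier ≃ bN.carrier} {φ' : bM'.carrier ≃ bN'.carrier}
    (h : IsBoundaryGluingWith bM bN φ IP jM jN) (h' : IsBoundaryGluingWith bM' bN' φ' IP jM' jN')
    (Φ : P ≃ₘ⟮IP, IP⟯ P') (hΦ : Φ '' range jN = range jN') :
    ∃ (ψM : M ≃ₘ⟮IM, JM⟯ M') (ψN : N ≃ₘ⟮IN, JN⟯ N'),
      Φ ∘ jM = jM' ∘ ψM ∧ Φ ∘ jN = jN' ∘ ψN := by
  obtain ⟨ψN, ψM, hN, hM⟩ := h.symm_equiv.exists_diffeomorph_pieces h'.symm_equiv Φ hΦ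
  exact ⟨ψM, ψN, hM, hN⟩

end Pieces

end Literature.Topology.FourManifolds
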